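import Summits.QuantumFields.YangMills.Theorems.PoincareLipschitzGapHolds
import Summits.QuantumFields.YangMills.Theorems.PoincareLipschitzTangentMapDensityCapHolds
import HarnessLib

/-!
# K2 crux `BlockLipschitzL` (stmt-QuantumFields-23533) ∕ crux `HistoryTailL` (stmt-QuantumFields-19936) — REGISTERED STUB `stub_uniformSmallScaleEnergy` (S1″) BY NAME
# (skeleton LINE 25 «CompactnessTransfer» v1.4-band A″ `Cruxes/HistoryTailL/Lines/compactness_transfer.lean` 5f6c9044e172a9d7, ideator ym-r3-idea-2 g15;
# route-QuantumFields-PoincareLipschitz; the stub text (1758 chars, registry copy) = the conclusion of px3 g9's ✓`PoincareLipschitzTangentMapDensityCapHolds.uniformSmallScaleEnergy_band_of_gap`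
# TOKEN FOR TOKEN, its one hypothesis (GAP) = ✓`PoincareLipschitzGapHolds.gap_holds` (this seat, over ROAD (H) + ROAD (W)) — this file gives the registry its by-name inhabitant;
# LEAD ★w1-19936 g10's standing plan 16:54:14Z (1): «S1″ STUB ALIAS, PEN := THE (GAP) PROVER»)

Cell `ym3-torus` (YM ladder rung R3 = continuum SU(2) Yang–Mills on the three-torus; NOT the Clay problem: not d = 4, not infinite volume, not a mass gap),
width seat `ym3-torus-px19` gen 8.  `--supports stmt-QuantumFields-23533` (STUB mode); THEOREMS ONLY (0 `def`, 0 `sorry`, default heartbeats).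
HONEST SCOPE.  S1″ (uniform small-scale energy for `W^{1,2}` local minimisers `Q → S³` in the band `Λ ≤ 21`) is a theorem of the tree by this alias;
`BlockLipschitzL` is LEAD's close (`blockLipschitzL_of_gap gap_holds`); K1-exp, (Q), `HistoryTailL` NOT proved here; no summit statement is proved here.
-/

set_option autoImplicit false

noncomputable section

open MeasureTheory Set Function Filter Topology Metric TopologicalSpace
open scoped ContDiff ENNReal BigOperators RealInnerProductSpace

namespace Summit.QuantumFields.YangMills.Theorems.PoincareLipschitzCompactnessTransferUniformSmallScaleEnergyStub

/-- **REGISTERED STUB `stub_uniformSmallScaleEnergy` (S1″, LINE 25 v1.4-band A″, registry text 1758 chars), BY NAME**: every finite-energy unit `W^{1,2}` map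
`Q → S³` minimising among competitors agreeing with it off a compact concentric sub-cube, with energy `≤ Λ ≤ 21`, has energy `≤ ε·r` on the concentric cube
of half-side `r ≤ r₁(Λ, ε)` — `:= uniformSmallScaleEnergy_band_of_gap gap_holds` (px3 g9's door ∘ the 8π gap). [cite: SchoenUhlenbeck1984, Proposition 1.2; Luckhaus1988, Thm 2; Simon1996, §2.9–2.10] -/
theorem stub_uniformSmallScaleEnergy :
    ∀ (Λ ε : ℝ), 0 < Λ → Λ ≤ 21 → 0 < ε → ∃ r₁ : ℝ, 0 < r₁ ∧ r₁ ≤ 1 / 8 ∧ ∀ (hQ : IsOpen {x : EuclideanSpace ℝ (Fin 3) | ∀ i : Fin 3, |x i| < 1}) (U : EuclideanSpace ℝ (Fin 3) → EuclideanSpace ℝ (Fin 4)) (G : EuclideanSpace ℝ (Fin 3) → (EuclideanSpace ℝ (Fin 3) →L[ℝ] EuclideanSpace ℝ (Fin 4))), Literature.Analysis.FunctionSpaces.HasWeakFDerivOn ⟨{x : EuclideanSpace ℝ (Fin 3) | ∀ i : Fin 3, |x i| < 1}, hQ⟩ volume U G → (∀ x : EuclideanSpace ℝ (Fin 3), (∀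 i : Fin 3, |x i| < 1) → ‖U x‖ = 1) → MeasureTheory.IntegrableOn (fun x => ∑ i : Fin 3, ‖G x (EuclideanSpace.single i (1:ℝ))‖ ^ 2) {x : EuclideanSpace ℝ (Fin 3) | ∀ i : Fin 3, |x i| < 1} → (∀ (V : EuclideanSpace ℝ (Fin 3) → EuclideanSpace ℝ (Fin 4)) (GV : EuclideanSpace ℝ (Fin 3) → (EuclideanSpace ℝ (Fin 3) →L[ℝ] EuclideanSpace ℝ (Fin 4))) (s : ℝ), s < 1 → Literature.Analysis.FunctionSpaces.HasWeakFDerivOn ⟨{x : EuclideanSpace ℝ (Fin 3) | ∀ i : Fin 3, |x i| < 1}, hQ⟩ volume V GV → (∀ x : EuclideanSpace ℝ (Fin 3), (∀ i : Fin 3, |x i| < 1) → ‖V x‖ = 1) → MeasureTheory.IntegrableOn (fun x => ∑ i : Fin 3, ‖GV x (EuclideanSpace.single i (1:ℝ))‖ ^ 2) {x : EuclideanSpace ℝ (Fin 3) | ∀ i : Fin 3, |x i| < 1} → (∀ x : EuclideanSpace ℝ (Fin 3), (∃ i : Fin 3, s ≤ |x i|) → V x = U x) → ∫ x in {x : EuclideanSpace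 ℝ (Fin 3) | ∀ i : Fin 3, |x i| < 1}, ∑ i : Fin 3, ‖G x (EuclideanSpace.single i (1:ℝ))‖ ^ 2 ≤ ∫ x in {x : EuclideanSpace ℝ (Fin 3) | ∀ i : Fin 3, |x i| < 1}, ∑ i : Fin 3, ‖GV x (EuclideanSpace.single i (1:ℝ))‖ ^ 2) → ∫ x in {x : EuclideanSpace ℝ (Fin 3) | ∀ i : Fin 3, |x i| < 1}, ∑ i : Fin 3, ‖G x (EuclideanSpace.single i (1:ℝ))‖ ^ 2 ≤ Λ → ∀ r : ℝ, 0 < r → r ≤ r₁ → ∫ x in {x : EuclideanSpace ℝ (Fin 3) | ∀ i : Fin 3, |x i| < r}, ∑ i : Fin 3, ‖G x (EuclideanSpace.single i (1:ℝ))‖ ^ 2 ≤ ε * r :=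
  Summit.QuantumFields.YangMills.Theorems.PoincareLipschitzTangentMapDensityCapHolds.uniformSmallScaleEnergy_band_of_gap
    Summit.QuantumFields.YangMills.Theorems.PoincareLipschitzGapHolds.gap_holds

end Summit.QuantumFields.YangMills.Theorems.PoincareLipschitzCompactnessTransferUniformSmallScaleEnergyStub
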